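import Literature.NumberTheory.Automorphic.FixedCosetsStableLattices   -- ★ the dictionary `γ·Λ(g) = Λ(g) ↔ γ·gK = gK`, `natCard_fixedBy_{glInt,unitary}_eq_ncard`
import HarnessLib

/-!
# `γ`-fixed cosets SPLIT BY A PREDICATE ON THEIR LATTICE: `#{q ∈ Fix_γ(G ⧸ K) | P(Λ(q.out))} = #{Λ ∈ γ-stable lattices of the orbit | P Λ}`
# (`G = GL_n(F) ⊃ GL_n(𝒪)` and `U(J) ⊃ U(J)(𝒪)`) — the count transport behind the DEPTH EXPANSION of an orbital integral
(Kottwitz 1986 §3; Laumon 1996 Lemma (5.3.2); Rogawski 1990 §4.9 — «counting fixed lattices level by level», Kottwitz 1988 §2)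

Topic `NumberTheory/Automorphic`; namespace `Literature.NumberTheory.Automorphic`.  THEOREMS ONLY (no definition, no instance, no notation, no named fact,
no `sorry`).  Cell `pub/hodgecm-mathlib`, crux H413 = stmt-HodgeConjecture-24833, road «R1LL-tree», brick (α) LAYER 2a (architect A-p16 (g27) RULINGS A-6 (c)(α) ∕
A-7 (a)): ★ p843062 `integral_conj_eq_smul_depthExpansion` produces `#{q ∈ Fix | d q = i}` for an abstract depth `d : G ⧸ K → ℕ`; with `d q := dep (Λ(q.out))`
(the lattice `Λ(g) = 𝒪-span of the columns of g`, ★ `FixedCosetsStableLattices`) THIS FILE rewrites those counts as LATTICE counts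
`#{Λ | (∃ u ∈ U, Λ = Λ(u)) ∧ γ Λ = Λ ∧ dep Λ = i}` — the currency of A-p13 (g31)'s ★ depth counts (`SelfDualStableLatticeDepthCount`) — by refining the
★ bijection `q ↦ Λ(q.out)` of `natCard_fixedBy_{glInt,unitary}_eq_ncard` with an arbitrary predicate `P` on lattices.  Seat F0P2-p01 (g10).
HONEST LABEL: HC_CM is proved only modulo the printed citations until rung 0 closes; this is generic bookkeeping and asserts nothing printed.

* §1 `GL_n`: `image_sep_fixedBy_glInt_eq`, **`ncard_sep_fixedBy_glInt_eq_ncard (γ) (P)`**.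
* §2 `U(J)`: `image_sep_fixedBy_unitary_eq`, **`ncard_sep_fixedBy_unitary_eq_ncard (γ) (P)`**; at `P := fun _ => True` these are the ★ counts.

## References
* [Kottwitz1986] R. E. Kottwitz, Compositio Math. 60 (1986), §3.  [Kottwitz1988] R. E. Kottwitz, *Tamagawa numbers*, Ann. of Math. 127 (1988), §2.
* [Laumon1995] G. Laumon, *Cohomology of Drinfeld Modular Varieties* I (1996), Lemma (5.3.2) p. 136.
* [Rogawski1990] J. D. Rogawski, Ann. of Math. Stud. 123 (1990), §4.9 Prop. 4.9.1 (b), Lemma 4.9.3.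
-/

set_option autoImplicit false
noncomputable section
open scoped ValuativeRel Matrix MatrixGroups
open Set
namespace Literature.NumberTheory.Automorphic

/-! ## §1 `GL_n(F) ⊃ GL_n(𝒪)` -/
section GLn
variable {F : Type*} [Field F] [ValuativeRel F] {n : ℕ}

/-- **`gK ↦ Λ(g)` maps `{q ∈ Fix_γ | P(Λ(q.out))}` ONTO the `γ`-stable lattices of the class of `𝒪ⁿ` satisfying `P`.** [cite: Kottwitz1986, §3]
[cite: Laumon1995, Lemma (5.3.2) p. 136] -/
theorem image_sep_fixedBy_glInt_eq (γ : GL (Fin n) F) (P : Submodule 𝒪[F] (Fin n → F) → Prop) :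
    (fun q : GL (Fin n) F ⧸ glInt n F => Submodule.span 𝒪[F] (Set.range (((q.out : GL (Fin n) F) : Matrix (Fin n) (Fin n) F))ᵀ)) ''
        {q ∈ MulAction.fixedBy (GL (Fin n) F ⧸ glInt n F) γ |
          P (Submodule.span 𝒪[F] (Set.range (((q.out : GL (Fin n) F) : Matrix (Fin n) (Fin n) F))ᵀ))} =
      {Λ : Submodule 𝒪[F] (Fin n → F) |
        (∃ g : GL (Fin n) F, Λ = Submodule.span 𝒪[F] (Set.range ((g : Matrix (Fin n) (Fin n) F))ᵀ)) ∧
          Λ.map ((Matrix.toLin' (γ : Matrix (Fin n) (Fin n) F)).restrictScalars 𝒪[F]) = Λ ∧ P Λ} := by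
  ext Λ
  simp only [mem_image, mem_setOf_eq]
  constructor
  · rintro ⟨q, ⟨hq, hP⟩, rfl⟩
    refine ⟨?_, ?_, hP⟩
    · exact ⟨q.out, rfl⟩
    · induction q using QuotientGroup.induction_on with
      | H g =>
        rw [span_range_transpose_out_eq]
        exact (map_span_range_transpose_eq_self_iff_smul_mk_eq γ g).2 hq
  · rintro ⟨⟨g, rfl⟩, hΛ, hP⟩
    exact ⟨(g : GL (Fin n) F ⧸ glInt n F),
      ⟨(map_span_range_transpose_eq_self_iff_smul_mk_eq γ g).1 hΛ, by rw [span_range_transpose_out_eq]; exact hP⟩,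
      span_range_transpose_out_eq g⟩

/-- **`#{q ∈ Fix_γ(GL_n(F) ⧸ GL_n(𝒪)) | P(Λ(q.out))} = #{Λ in the class of 𝒪ⁿ | γ Λ = Λ ∧ P Λ}`** (`Set.ncard`) — ★ `natCard_fixedBy_glInt_eq_ncard` refined
by an arbitrary predicate `P` on lattices (e.g. «depth `= i`»). [cite: Kottwitz1986, §3] [cite: Kottwitz1988, §2] [cite: Laumon1995, Lemma (5.3.2) p. 136] -/
theorem ncard_sep_fixedBy_glInt_eq_ncard (γ : GL (Fin n) F) (P : Submodule 𝒪[F] (Fin n → F) → Prop) :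
    {q ∈ MulAction.fixedBy (GL (Fin n) F ⧸ glInt n F) γ |
        P (Submodule.span 𝒪[F] (Set.range (((q.out : GL (Fin n) F) : Matrix (Fin n) (Fin n) F))ᵀ))}.ncard =
      {Λ : Submodule 𝒪[F] (Fin n → F) |
        (∃ g : GL (Fin n) F, Λ = Submodule.span 𝒪[F] (Set.range ((g : Matrix (Fin n) (Fin n) F))ᵀ)) ∧
          Λ.map ((Matrix.toLin' (γ : Matrix (Fin n) (Fin n) F)).restrictScalars 𝒪[F]) = Λ ∧ P Λ}.ncard := by
  rw [← image_sep_fixedBy_glInt_eq γ P, (injOn_span_out_glInt _).ncard_image]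

end GLn

/-! ## §2 The unitary group `U(J) ⊃ U(J)(𝒪)` -/
section Unitary
variable {E : Type*} [Field E] [ValuativeRel E] {n : ℕ} (σ : E →+* E) (J : GL (Fin n) E)

/-- `Λ(out (u K_U)) = Λ(u)` in `U = U(J)` (`K_U = U ∩ GL_n(𝒪)`). [cite: Kottwitz1986, §3] -/
theorem span_range_transpose_out_eq_unitary (u : ↥(unitaryGroupOfForm σ (J : Matrix (Fin n) (Fin n) E))) :
    Submodule.span 𝒪[E] (Set.range ((((((u : ↥(unitaryGroupOfForm σ (J : Matrix (Fin n) (Fin n) E))) :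
        ↥(unitaryGroupOfForm σ (J : Matrix (Fin n) (Fin n) E)) ⧸ (glInt n E).subgroupOf (unitaryGroupOfForm σ (J : Matrix (Fin n) (Fin n) E))).out :
          ↥(unitaryGroupOfForm σ (J : Matrix (Fin n) (Fin n) E))) : GL (Fin n) E) : Matrix (Fin n) (Fin n) E))ᵀ) =
      Submodule.span 𝒪[E] (Set.range ((((u : GL (Fin n) E)) : Matrix (Fin n) (Fin n) E))ᵀ) := by
  obtain ⟨k, hk⟩ := QuotientGroup.mk_out_eq_mul ((glInt n E).subgroupOf (unitaryGroupOfForm σ (J : Matrix (Fin n) (Fin n) E))) u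
  rw [hk, Subgroup.coe_mul, eq_comm, span_range_transpose_eq_iff, inv_mul_cancel_left]
  exact (Subgroup.mem_subgroupOf).1 k.2

/-- `q ↦ Λ(q.out)` is injective on `U ⧸ K_U`. [cite: Kottwitz1986, §3] -/
theorem injOn_span_out_unitary
    (S : Set (↥(unitaryGroupOfForm σ (J : Matrix (Fin n) (Fin n) E)) ⧸ (glInt n E).subgroupOf (unitaryGroupOfForm σ (J : Matrix (Fin n) (Fin n) E)))) :
    Set.InjOn (fun q : ↥(unitaryGroupOfForm σ (J : Matrix (Fin n) (Fin n) E)) ⧸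
        (glInt n E).subgroupOf (unitaryGroupOfForm σ (J : Matrix (Fin n) (Fin n) E)) =>
      Submodule.span 𝒪[E] (Set.range ((((q.out : ↥(unitaryGroupOfForm σ (J : Matrix (Fin n) (Fin n) E))) : GL (Fin n) E) :
        Matrix (Fin n) (Fin n) E))ᵀ)) S := by
  intro q _ q' _ h
  have h' := (span_range_transpose_eq_iff
    ((q.out : ↥(unitaryGroupOfForm σ (J : Matrix (Fin n) (Fin n) E))) : GL (Fin n) E)
    ((q'.out : ↥(unitaryGroupOfForm σ (J : Matrix (Fin n) (Fin n) E))) : GL (Fin n) E)).1 h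
  rw [← Quotient.out_eq q, ← Quotient.out_eq q']
  refine QuotientGroup.eq.2 ((Subgroup.mem_subgroupOf).2 ?_)
  rw [Subgroup.coe_mul, Subgroup.coe_inv]
  exact h'

/-- **`u K_U ↦ Λ(u)` maps `{q ∈ Fix_γ(U ⧸ K_U) | P(Λ(q.out))}` ONTO the `γ`-stable lattices `Λ(u)`, `u ∈ U`, satisfying `P`.**
[cite: Kottwitz1986, §3] [cite: Laumon1995, Lemma (5.3.2) p. 136] -/
theorem image_sep_fixedBy_unitary_eq (γ : ↥(unitaryGroupOfForm σ (J : Matrix (Fin n) (Fin n) E)))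
    (P : Submodule 𝒪[E] (Fin n → E) → Prop) :
    (fun q : ↥(unitaryGroupOfForm σ (J : Matrix (Fin n) (Fin n) E)) ⧸
        (glInt n E).subgroupOf (unitaryGroupOfForm σ (J : Matrix (Fin n) (Fin n) E)) =>
      Submodule.span 𝒪[E] (Set.range ((((q.out : ↥(unitaryGroupOfForm σ (J : Matrix (Fin n) (Fin n) E))) : GL (Fin n) E) :
        Matrix (Fin n) (Fin n) E))ᵀ)) ''
        {q ∈ MulAction.fixedBy (↥(unitaryGroupOfForm σ (J : Matrix (Fin n) (Fin n) E)) ⧸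
            (glInt n E).subgroupOf (unitaryGroupOfForm σ (J : Matrix (Fin n) (Fin n) E))) γ |
          P (Submodule.span 𝒪[E] (Set.range ((((q.out : ↥(unitaryGroupOfForm σ (J : Matrix (Fin n) (Fin n) E))) : GL (Fin n) E) :
            Matrix (Fin n) (Fin n) E))ᵀ))} =
      {Λ : Submodule 𝒪[E] (Fin n → E) |
        (∃ u ∈ unitaryGroupOfForm σ (J : Matrix (Fin n) (Fin n) E), Λ = Submodule.span 𝒪[E] (Set.range ((u : Matrix (Fin n) (Fin n) E))ᵀ)) ∧
          Λ.map ((Matrix.toLin' (((γ : GL (Fin n) E) : Matrix (Fin n) (Fin n) E))).restrictScalars 𝒪[E]) = Λ ∧ P Λ} := by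
  ext Λ
  simp only [mem_image, mem_setOf_eq]
  constructor
  · rintro ⟨q, ⟨hq, hP⟩, rfl⟩
    induction q using QuotientGroup.induction_on with
    | H u =>
      rw [span_range_transpose_out_eq_unitary σ J u] at hP ⊢
      exact ⟨⟨u, u.2, rfl⟩, (map_span_range_transpose_eq_self_iff_smul_mk_eq_unitary σ J γ u).2 hq, hP⟩
  · rintro ⟨⟨u, hu, rfl⟩, hΛ, hP⟩
    refine ⟨((⟨u, hu⟩ : ↥(unitaryGroupOfForm σ (J : Matrix (Fin n) (Fin n) E))) :
        ↥(unitaryGroupOfForm σ (J : Matrix (Fin n) (Fin n) E)) ⧸ (glInt n E).subgroupOf (unitaryGroupOfForm σ (J : Matrix (Fin n) (Fin n) E))),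
      ⟨(map_span_range_transpose_eq_self_iff_smul_mk_eq_unitary σ J γ ⟨u, hu⟩).1 hΛ, ?_⟩, span_range_transpose_out_eq_unitary σ J ⟨u, hu⟩⟩
    rw [span_range_transpose_out_eq_unitary σ J ⟨u, hu⟩]
    exact hP

/-- **`#{q ∈ Fix_γ(U ⧸ K_U) | P(Λ(q.out))} = #{Λ(u), u ∈ U | γ Λ = Λ ∧ P Λ}`** (`Set.ncard`) for `U = U(J) ≤ GL_n(E)`, `K_U = U ∩ GL_n(𝒪)` — ★
`natCard_fixedBy_unitary_eq_ncard` refined by an arbitrary predicate `P` on lattices: with `P Λ := (dep Λ = i)` these are the depth-`i` terms of ★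
`integral_conj_eq_smul_depthExpansion` (p843062) read as LATTICE counts (★ `SelfDualStableLatticeDepthCount`; the `Λ(u)` are the self-dual lattices, ★
`exists_mem_unitary_span_eq_iff_selfDual`). [cite: Kottwitz1992, §7 Cor. 7.3] [cite: Kottwitz1988, §2] [cite: Rogawski1990, §4.9 Prop. 4.9.1 (b) p. 55] -/
theorem ncard_sep_fixedBy_unitary_eq_ncard (γ : ↥(unitaryGroupOfForm σ (J : Matrix (Fin n) (Fin n) E)))
    (P : Submodule 𝒪[E] (Fin n → E) → Prop) :
    {q ∈ MulAction.fixedBy (↥(unitaryGroupOfForm σ (J : Matrix (Fin n) (Fin n) E)) ⧸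
          (glInt n E).subgroupOf (unitaryGroupOfForm σ (J : Matrix (Fin n) (Fin n) E))) γ |
        P (Submodule.span 𝒪[E] (Set.range ((((q.out : ↥(unitaryGroupOfForm σ (J : Matrix (Fin n) (Fin n) E))) : GL (Fin n) E) :
          Matrix (Fin n) (Fin n) E))ᵀ))}.ncard =
      {Λ : Submodule 𝒪[E] (Fin n → E) |
        (∃ u ∈ unitaryGroupOfForm σ (J : Matrix (Fin n) (Fin n) E), Λ = Submodule.span 𝒪[E] (Set.range ((u : Matrix (Fin n) (Fin n) E))ᵀ)) ∧
          Λ.map ((Matrix.toLin' (((γ : GL (Fin n) E) : Matrix (Fin n) (Fin n) E))).restrictScalars 𝒪[E]) = Λ ∧ P Λ}.ncard := by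
  rw [← image_sep_fixedBy_unitary_eq σ J γ P, (injOn_span_out_unitary σ J _).ncard_image]

end Unitary

end Literature.NumberTheory.Automorphic

end
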